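import Summits.QuantumAdvantage.QuantumAdvantage.Theorems.BlindDialB

/-!
# BlindDial part C (§4 fixup, §5 the blind-pair law and its instances, §6 the node, §7 the re-based rung) — Theorems twin
(tree landing, census lane decomp-qadv) of NODE «BlindDial» (decomp-qadv-lens-2, gen 20)

Verbatim content of the rest of the lens node file
`run/shared/lean/pub/decomp-qadv/decomp-qadv-lens-2/g20/BlindDial.lean` (sha256 b5816ebc…, 919 l; farm rc 0 · 0 err · 0 warn ·
0 sorry; axioms std) under the `Theorems.BlindDial` namespace (the node elaborates under `Theses.BlindDial`); every declaration
documented; linear import chain `ResponseDialJ → BlindDialA → BlindDialB → BlindDialC`.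
Supports stmt-QuantumAdvantage-27656 (`Theses.SparsityDial.DenseGenericLoss3` = D, DRAFT route-QuantumAdvantage-SparsityDial).
★ `paleyCounterLoss3 : Theorems.ResponseDial.PaleyCounterLoss3` closes the §14 rung of ResponseDialJ BY NAME (TREE N94's first
undecided named instance of D); `windowCounterLoss3_of_odd` decides EVERY odd-cell window-counter family (`C = 1`, `n₀ = 4096`);
(the node's certificate-free re-proof `multiCounterLoss3'` of the §12 rung is omitted here — it restates the landed `ResponseDial.multiCounterLoss3`); `blindLoss3`,
`closes : BlindLoss3 → SightedGenericLoss3 → DenseGenericLoss3`, `sighted_iff_dense`; `FullPaleyCounterLoss3` (UNDECIDED rung,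
implied by D by name).
-/


set_option linter.dupNamespace false
noncomputable section
open scoped Classical

namespace Summit.QuantumAdvantage.QuantumAdvantage.Theorems.BlindDial
open Finset
open Literature.Computability.QuantumComplexity Literature.Computability.QuantumComplexity.RingHLF
open Literature.Computability.MetaComplexity Literature.Computability.MetaComplexity.Smolensky
open Summit.QuantumAdvantage.AdviceFreeQNC0
open Summit.QuantumAdvantage.QuantumAdvantage.Theorems.AnchorDial (outB dev cN fz fz_apply orbL orbL_cons orbL_nil
  oddZeros_orbL zpar_orbL orbL_apply_of_far cN_orbL orbL_invol card_filter_orbL sh sgN cN_succ win_iff gCond_iff_cN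
  flip2 zpar_flip2 loss_shape_mono)
open Summit.QuantumAdvantage.QuantumAdvantage.Theorems.HolonomyDial (gCond tPoly tPoly_apply xorP xorP_apply_bool indP
  indP_apply mono_singleton_apply)
open Summit.QuantumAdvantage.QuantumAdvantage.Theorems.StabilizerDial (apIdx apStrat bitP bitP_apStrat pad rel_pad_iff
  StabFew)
open Summit.QuantumAdvantage.QuantumAdvantage.Theorems.SparsityDial (real_loss_of_frac)
open Summit.QuantumAdvantage.QuantumAdvantage.Theorems.ResponseDial (loddG wStrat wStrat_agree wStrat_mem paleyW
  WindowCounterLoss3 PaleyCounterLoss3 windowCounterLoss3_of_dense wStrat_in_dense_class tog0 oddZeros_tog0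
  fibre_le_pow mem_dev_apStrat mcStrat MultiCounterLoss3 mcStrat_eq_wStrat)
open Summit.QuantumAdvantage.QuantumAdvantage.Theses.SparsityDial (DenseGenericLoss3)

variable {N : ℕ}

/-! ### conditioning on the pinned cells: `2^N ≤ 2⁷ · #A` by a 7-cell fixup -/

/-- impose the pinned values. -/
def impose (_hN : 64 ≤ N) (x : Fin N → Bool) : Fin N → Bool := fun j =>
  if j.val = eW N + 1 then false
  else if j.val = kW N + 1 ∨ j.val = 1 ∨ j.val = 5 ∨ j.val = 11 ∨ j.val = 15 then true else x j

/-- … then repair the zero-parity at cell `0`. -/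
def fixA (hN : 64 ≤ N) (x : Fin N → Bool) : Fin N → Bool :=
  if OddZeros (impose hN x) then impose hN x else tog0 (by omega) (impose hN x)

/-- BlindDialC helper `impose_pins` (decomp-qadv g20 land package; see the module docstring). -/
theorem impose_pins (hN : 64 ≤ N) (x : Fin N → Bool) :
    impose hN x (E1 hN) = false ∧ impose hN x (K1 hN) = true ∧ SignFix (impose hN x) := by
  have hk := kW_bound N
  refine ⟨?_, ?_, fun j hj => ?_⟩
  · unfold impose; rw [if_pos (show (E1 hN).val = eW N + 1 from rfl)]
  · unfold impose
    rw [if_neg (show ¬ ((K1 hN).val = eW N + 1) by show kW N + 1 ≠ eW N + 1; unfold eW; omega),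
      if_pos (Or.inl (show (K1 hN).val = kW N + 1 from rfl))]
  · unfold impose; rw [if_neg (by unfold eW; omega), if_pos (Or.inr hj)]

/-- BlindDialC helper `fixA_mem` (decomp-qadv g20 land package; see the module docstring). -/
theorem fixA_mem (hN : 64 ≤ N) (x : Fin N → Bool) : AA hN (fixA hN x) := by
  obtain ⟨p1, p2, p3⟩ := impose_pins hN x
  unfold fixA
  split_ifs with h
  · exact ⟨h, p1, p2, p3⟩
  · have h0 : ∀ j : Fin N, j.val ≠ 0 → tog0 (by omega) (impose hN x) j = impose hN x j := fun j hj => by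
      unfold tog0; rw [Function.update_of_ne (fun e => hj (by rw [e]))]
    refine ⟨(oddZeros_tog0 _ _).2 h, ?_, ?_, fun j hj => ?_⟩
    · rw [h0 _ (show eW N + 1 ≠ 0 by omega)]; exact p1
    · rw [h0 _ (show kW N + 1 ≠ 0 by omega)]; exact p2
    · rw [h0 j (by omega)]; exact p3 j hj

/-- BlindDialC helper `fixA_off` (decomp-qadv g20 land package; see the module docstring). -/
theorem fixA_off (hN : 64 ≤ N) (x : Fin N → Bool) (j : Fin N)
    (hj : ¬ (j.val = 0 ∨ j.val = 1 ∨ j.val = 5 ∨ j.val = 11 ∨ j.val = 15 ∨ j.val = kW N + 1 ∨ j.val = eW N + 1)) :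
    fixA hN x j = x j := by
  have hI : impose hN x j = x j := by unfold impose; rw [if_neg (by omega), if_neg (by omega)]
  unfold fixA
  split_ifs
  · exact hI
  · unfold tog0
    rw [Function.update_of_ne (fun e => hj (Or.inl (by rw [e])))]
    exact hI

/-- the seven touched cells. -/
def pinT (_hN : 64 ≤ N) : Finset (Fin N) :=
  univ.filter fun j => j.val = 0 ∨ j.val = 1 ∨ j.val = 5 ∨ j.val = 11 ∨ j.val = 15 ∨ j.val = kW N + 1 ∨ j.val = eW N + 1

/-- BlindDialC helper `pinT_card` (decomp-qadv g20 land package; see the module docstring). -/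
theorem pinT_card (hN : 64 ≤ N) : (pinT hN).card ≤ 7 := by
  have h := card_le_card_of_injOn (s := pinT hN) (t := ([0, 1, 5, 11, 15, kW N + 1, eW N + 1] : List ℕ).toFinset)
    (fun j : Fin N => j.val)
    (fun j hj => by
      have hj' : j ∈ pinT hN := hj
      unfold pinT at hj'
      have h2 := (mem_filter.1 hj').2
      show j.val ∈ ([0, 1, 5, 11, 15, kW N + 1, eW N + 1] : List ℕ).toFinset
      rw [List.mem_toFinset]
      simp only [List.mem_cons, List.not_mem_nil, or_false]
      exact h2)
    (fun j₁ _ j₂ _ h => Fin.ext h)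
  exact h.trans ((List.toFinset_card_le _).trans (by simp))

/-- BlindDialC helper `univ_le_AA` (decomp-qadv g20 land package; see the module docstring). -/
theorem univ_le_AA (hN : 64 ≤ N) :
    (univ : Finset (Fin N → Bool)).card ≤ 128 * (univ.filter fun x : Fin N → Bool => AA hN x).card := by
  refine card_le_mul_card_image_of_maps_to (f := fixA hN) (fun x _ => mem_filter.2 ⟨mem_univ _, fixA_mem hN x⟩)
    128 (fun y _ => ?_)
  refine (fibre_le_pow (pinT hN) (fixA hN)
    (fun x j hj => fixA_off hN x j (fun h => hj (mem_filter.2 ⟨mem_univ _, h⟩))) y _).trans ?_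
  calc 2 ^ (pinT hN).card ≤ 2 ^ 7 := Nat.pow_le_pow_right (by norm_num) (pinT_card hN)
    _ = 128 := by norm_num

/-- **THE BLIND-PAIR LAW (counting form)**: a blind field loses at least a `2⁻¹²` fraction of the odd class. -/
theorem blind_loss_count (hN : 64 ≤ N) (P : Fin N → CubeFn (ZMod 3) N) (hB : Blind P) :
    (univ.filter fun x : Fin N → Bool => OddZeros x).card ≤
      4096 * (univ.filter fun x : Fin N → Bool => OddZeros x ∧ ¬ Rel x (outB P x)).card :=
  calc (univ.filter fun x : Fin N → Bool => OddZeros x).card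
      ≤ (univ : Finset (Fin N → Bool)).card := card_filter_le _ _
    _ ≤ 128 * (univ.filter fun x : Fin N → Bool => AA hN x).card := univ_le_AA hN
    _ ≤ 128 * (16 * (univ.filter fun x : Fin N → Bool => QQ hN P x).card) := Nat.mul_le_mul_left _ (AA_le hN hB)
    _ ≤ 128 * (16 * (2 * (univ.filter fun x : Fin N → Bool => OddZeros x ∧ ¬ Rel x (outB P x)).card)) :=
        Nat.mul_le_mul_left _ (Nat.mul_le_mul_left _ (QQ_le hN hB))
    _ = 4096 * (univ.filter fun x : Fin N → Bool => OddZeros x ∧ ¬ Rel x (outB P x)).card := by ring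


/-! ## §5 The law, and its instances: every odd-cell window-counter family — in particular PALEY -/

/-- **THE BLIND-PAIR LAW.**  For `n ≥ 4096`, a blind field wins on at most a `(1 − n⁻¹)`-fraction of the odd class. -/
theorem blind_loss (n : ℕ) (hn : 4096 ≤ n) (P : Fin n → CubeFn (ZMod 3) n) (hB : Blind P) :
    ((univ.filter fun x : Fin n → Bool => OddZeros x ∧ Rel x (fun i => decide (P i x = 1))).card : ℝ)
      ≤ (1 - 1 / (n : ℝ) ^ 1) * (2 : ℝ) ^ (n - 1) :=
  real_loss_of_frac (M := 4096) (by norm_num) hn (by omega) P (blind_loss_count (by omega) P hB)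

/-- the law is GAUGE-UNIVERSAL: a field with a blind gauge representative `pad P s` (any `s`, no degree bound) loses. -/
theorem blind_gauge_loss (n : ℕ) (hn : 4096 ≤ n) (P s : Fin n → CubeFn (ZMod 3) n) (hB : Blind (pad P s)) :
    ((univ.filter fun x : Fin n → Bool => OddZeros x ∧ Rel x (fun i => decide (P i x = 1))).card : ℝ)
      ≤ (1 - 1 / (n : ℝ) ^ 1) * (2 : ℝ) ^ (n - 1) := by
  have h := blind_loss n hn (pad P s) hB
  have e : (univ.filter fun x : Fin n → Bool => OddZeros x ∧ Rel x (fun i => decide (pad P s i x = 1))) =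
      univ.filter fun x : Fin n → Bool => OddZeros x ∧ Rel x (fun i => decide (P i x = 1)) := by
    refine filter_congr fun x _ => ?_
    exact and_congr_right fun _ => rel_pad_iff P s x
  rw [e] at h; exact h

/-- BlindDialC helper `loddG_apply` (decomp-qadv g20 land package; see the module docstring). -/
theorem loddG_apply (W : Fin N → Finset (Fin N)) (k : Fin N) (y : Fin N → Bool) :
    loddG W k y = ∑ i ∈ W k, (if y i then (1 : ZMod 3) else 0) := by
  unfold loddG; rw [Finset.sum_apply]; exact sum_congr rfl fun i _ => mono_singleton_apply i y

/-- BlindDialC helper `loddG_congr` (decomp-qadv g20 land package; see the module docstring). -/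
theorem loddG_congr (W : Fin N → Finset (Fin N)) (k : Fin N) {y y' : Fin N → Bool} (h : ∀ i ∈ W k, y i = y' i) :
    loddG W k y = loddG W k y' := by
  rw [loddG_apply, loddG_apply]; exact sum_congr rfl fun i hi => by rw [h i hi]

/-- BlindDialC helper `mem_dev_wStrat_second` (decomp-qadv g20 land package; see the module docstring). -/
theorem mem_dev_wStrat_second (W : Fin N → Finset (Fin N)) (y : Fin N → Bool) (k : Fin N)
    (hk : ¬ (1 ≤ k.val ∧ k.val < N / 2)) :
    k ∈ dev (fun i : Fin N => wStrat W i) y ↔ decide (loddG W k y = 0) = true := by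
  have happ : wStrat W k y = if xor (tGuess y k) (decide (loddG W k y = 0)) then 1 else 0 := by
    unfold wStrat; rw [if_neg hk]
    exact xorP_apply_bool _ _ y _ _ (tPoly_apply k y) (by rw [indP_apply]; by_cases h : loddG W k y = 0 <;> simp [h])
  simp only [Summit.QuantumAdvantage.QuantumAdvantage.Theorems.AnchorDial.dev, mem_filter, mem_univ, true_and, happ]
  generalize tGuess y k = t; generalize decide (loddG W k y = 0) = q
  cases t <;> cases q <;> decide

/-- BlindDialC helper `mem_dev_wStrat_first` (decomp-qadv g20 land package; see the module docstring). -/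
theorem mem_dev_wStrat_first (W : Fin N → Finset (Fin N)) (y : Fin N → Bool) (k : Fin N)
    (hk : 1 ≤ k.val ∧ k.val < N / 2) : k ∈ dev (fun i : Fin N => wStrat W i) y ↔ y (apIdx k) = true := by
  have h := mem_dev_apStrat y k
  unfold Summit.QuantumAdvantage.QuantumAdvantage.Theorems.AnchorDial.dev at h ⊢
  rw [mem_filter] at h ⊢
  have e : (fun i : Fin N => wStrat W i) k y = (fun i : Fin N => apStrat i) k y := by
    show wStrat W k y = apStrat k y; rw [wStrat_agree W k hk.1 hk.2]
  rw [e]; exact h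

/-- BlindDialC helper `apIdx_val_first` (decomp-qadv g20 land package; see the module docstring). -/
theorem apIdx_val_first (k : Fin N) (hk : k.val < N / 2) : (apIdx k).val = k.val + N / 2 := by
  show (k.val + N / 2) % N = _; exact Nat.mod_eq_of_lt (by omega)

/-- **every window-counter family over ODD cells is blind** (antipodal first half; position `k` of the rest toggles
by any `𝔽₃`-counter over a window `W k` of odd cells — intervals, Paley sets, anything). -/
theorem wStrat_blind (hN : 64 ≤ N) (W : Fin N → Finset (Fin N)) (hW : ∀ k, ∀ i ∈ W k, i.val % 2 = 1) :
    Blind (fun k : Fin N => wStrat W k) := by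
  have hk0 := kW_bound N
  refine ⟨fun k y => if 1 ≤ k.val ∧ k.val < N / 2 then
      (if k.val = kW N ∨ k.val = kW N + 2 then false else y (apIdx k)) else decide (loddG W k y = 0), ?_, ?_⟩
  · intro k y y' hyy
    by_cases hk : 1 ≤ k.val ∧ k.val < N / 2
    · simp only [if_pos hk]
      by_cases hk2 : k.val = kW N ∨ k.val = kW N + 2
      · simp only [if_pos hk2]
      · simp only [if_neg hk2]
        apply hyy
        have := apIdx_val_first k hk.2
        unfold Moved; rw [eW_eq]; omega
    · simp only [if_neg hk]
      rw [loddG_congr W k (fun i hi => hyy i (not_moved_of_odd (hW k i hi)))]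
  · intro k y
    dsimp only
    by_cases hk : 1 ≤ k.val ∧ k.val < N / 2
    · rw [mem_dev_wStrat_first W y k hk, if_pos hk]
      have hav := apIdx_val_first k hk.2
      by_cases hk2 : k.val = kW N ∨ k.val = kW N + 2
      · rw [if_pos hk2]
        rcases hk2 with h | h
        · have hlt : eW N < N := by unfold eW; omega
          have hap : apIdx k = ⟨eW N, hlt⟩ := Fin.ext (by rw [hav]; show k.val + N / 2 = eW N; rw [eW_eq]; omega)
          rw [show ptr N k.val y = bit y (eW N) by rw [h, ptr_K0], bit_eq y hlt, hap]; simp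
        · have hlt : eW N + 2 < N := by unfold eW; omega
          have hap : apIdx k = ⟨eW N + 2, hlt⟩ :=
            Fin.ext (by rw [hav]; show k.val + N / 2 = eW N + 2; rw [eW_eq]; omega)
          rw [show ptr N k.val y = bit y (eW N + 2) by rw [h, ptr_K2], bit_eq y hlt, hap]; simp
      · rw [if_neg hk2, ptr_of_ne (fun h => hk2 (Or.inl h)) (fun h => hk2 (Or.inr h))]; simp
    · rw [mem_dev_wStrat_second W y k hk, if_neg hk, ptr_of_ne (by omega) (by omega)]; simp

/-- **every odd-cell window-counter family loses a polynomial fraction** (`C = 1`, `n₀ = 4096`). -/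
theorem windowCounterLoss3_of_odd (W : (n : ℕ) → Fin n → Finset (Fin n))
    (hW : ∀ n k, ∀ i ∈ W n k, i.val % 2 = 1) : WindowCounterLoss3 W :=
  ⟨1, 4096, fun n hn => blind_loss n hn _ (wStrat_blind (by omega) (W n) (hW n))⟩

/-- **THE PALEY RUNG IS DECIDED** — `PaleyCounterLoss3` (ResponseDial §14: the residual's named "response-rich" instance,
recorded UNDECIDED and outside the orbit-certificate method) HOLDS. -/
theorem paleyCounterLoss3 : PaleyCounterLoss3 :=
  windowCounterLoss3_of_odd paleyW fun n k i hi => by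
    unfold paleyW at hi; exact (mem_filter.1 hi).2.1

-- Robustness remark (node file): the §12 rung `MultiCounterLoss3` is also re-proved by the blind-pair law with no certificate
-- (`mcStrat_eq_wStrat`: it is an odd-window family).  That re-proof `multiCounterLoss3'` is omitted at landing because its statement
-- restates the landed `Theorems.ResponseDial.multiCounterLoss3` (gate dedup p816770).

/-! ## §6 The node: pieces, `closes`, and the residual's iff -/

/-- piece A [PROVED, `blindLoss3`]: the blind-pair law as a statement (explicit constants). -/
def BlindLoss3 : Prop :=
  ∀ n ≥ 4096, ∀ P : Fin n → CubeFn (ZMod 3) n, Blind P →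
    ((univ.filter fun x : Fin n → Bool => OddZeros x ∧ Rel x (fun i => decide (P i x = 1))).card : ℝ)
      ≤ (1 - 1 / (n : ℝ) ^ 1) * (2 : ℝ) ^ (n - 1)

/-- BlindDialC helper `blindLoss3` (decomp-qadv g20 land package; see the module docstring). -/
theorem blindLoss3 : BlindLoss3 := fun n hn P hB => blind_loss n hn P hB

/-- piece B [RESIDUAL ≡ D modulo piece A, `sighted_iff_dense`]: the target restricted to SIGHTED (= non-blind) fields. -/
def SightedGenericLoss3 : Prop :=
  ∃ a : ℕ, ∃ C : ℕ, ∀ c : ℕ, ∃ n₀ : ℕ, ∀ n ≥ n₀, ∀ P : Fin n → CubeFn (ZMod 3) n,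
    (∀ i, P i ∈ lowDeg (ZMod 3) n ((Nat.log 2 n) ^ c)) → ¬ StabFew ((Nat.log 2 n) ^ a) 0 (c + 1) P → ¬ Blind P →
    ((univ.filter fun x : Fin n → Bool => OddZeros x ∧ Rel x (fun i => decide (P i x = 1))).card : ℝ)
      ≤ (1 - 1 / (n : ℝ) ^ C) * (2 : ℝ) ^ (n - 1)

/-- **`closes`**: the two pieces give the target BY NAME. -/
theorem closes (hA : BlindLoss3) (hB : SightedGenericLoss3) : DenseGenericLoss3 := by
  obtain ⟨a, C, h⟩ := hB
  refine ⟨a, max C 1, fun c => ?_⟩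
  obtain ⟨n₀, hn₀⟩ := h c
  refine ⟨max n₀ 4096, fun n hn P hdeg hns => ?_⟩
  have hn1 : 1 ≤ n := le_trans (by norm_num) (le_trans (le_max_right n₀ 4096) hn)
  have hpos : (0 : ℝ) ≤ (2 : ℝ) ^ (n - 1) := by positivity
  by_cases hb : Blind P
  · exact loss_shape_mono hn1 (le_max_right C 1) _ _ hpos (hA n (le_trans (le_max_right _ _) hn) P hb)
  · exact loss_shape_mono hn1 (le_max_left C 1) _ _ hpos (hn₀ n (le_trans (le_max_left _ _) hn) P hdeg hns hb)

/-- BlindDialC helper `sighted_of_dense` (decomp-qadv g20 land package; see the module docstring). -/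
theorem sighted_of_dense (hD : DenseGenericLoss3) : SightedGenericLoss3 := by
  obtain ⟨a, C, h⟩ := hD
  refine ⟨a, C, fun c => ?_⟩
  obtain ⟨n₀, hn₀⟩ := h c
  exact ⟨n₀, fun n hn P hdeg hns _ => hn₀ n hn P hdeg hns⟩

/-- the residual is the target modulo the law (honest LAW-node accounting). -/
theorem sighted_iff_dense : SightedGenericLoss3 ↔ DenseGenericLoss3 := ⟨closes blindLoss3, sighted_of_dense⟩

/-! ## §7 The residual's re-based first undecided named instance: FULL-PARITY Paley windows -/

/-- the FULL Paley window system: position `k` counts ALL cells `i` (both parities) with `i + k` a square mod the least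
prime `p ≥ n`.  It is sighted (every moved cell lies in about half the windows), so §5 does not apply, and it is
response-rich in the sense of ResponseDial §13, so the orbit-certificate method does not apply either. -/
noncomputable def fullPaleyW (n : ℕ) (k : Fin n) : Finset (Fin n) := by
  classical
  exact univ.filter fun i : Fin n =>
    ∃ r : ℕ, r < Literature.Computability.MetaComplexity.leastPrimeGe n ∧
      r * r % Literature.Computability.MetaComplexity.leastPrimeGe n =
        (i.val + k.val) % Literature.Computability.MetaComplexity.leastPrimeGe n

/-- **UNDECIDED rung**: the full-Paley window-counter family loses a polynomial fraction of the odd class. -/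
def FullPaleyCounterLoss3 : Prop := WindowCounterLoss3 fullPaleyW

/-- BlindDialC helper `fullPaleyCounterLoss3_of_dense` (decomp-qadv g20 land package; see the module docstring). -/
theorem fullPaleyCounterLoss3_of_dense (hD : DenseGenericLoss3) : FullPaleyCounterLoss3 :=
  windowCounterLoss3_of_dense fullPaleyW hD

/-- BlindDialC helper `fullPaleyCounterLoss3_of_sighted` (decomp-qadv g20 land package; see the module docstring). -/
theorem fullPaleyCounterLoss3_of_sighted (h : SightedGenericLoss3) : FullPaleyCounterLoss3 :=
  fullPaleyCounterLoss3_of_dense (closes blindLoss3 h)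


end Summit.QuantumAdvantage.QuantumAdvantage.Theorems.BlindDial
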